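/-
Copyright (c) 2026 the pub-hodgecm-mathlib formalisation cell (harness21).  Prover seat hodgecm-mathlib-K2E1-p15 (g5) ((V) OF RECORD KEEPER; frame-pack service), Track B ∕ K2-LIT,
h413 = `stmt-HodgeConjecture-24833`, R90-TF section S8 «ContSpec-n½», socket B MID :358, the GENERAL SUB-ROW (V-τ) (RULING J-S8-M3′ (c); K2E1-p14 (g5)'s ★ p865372): the (V-τ)
letter head `resGMidBlock_ne_bot_of_tauGenerator_letters` RE-EXPORTED with the exports' frame (F)(F′) DISCHARGED in-file, by the roads of R90-CS-p03 (g4)'s ★ p865286 frame pack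
(typ2 (g4) FRAME LEDGER): the σ-algebras of `G_∞` and `G_f` (`borel _`, `⟨rfl⟩`), the `G`-side cluster `νG β μZ hβ hμZ` with its instances (ONE `obtain` from ★
`exists_haar_coveringWeight_unfoldedMeasure_cm_three`), the port Haar measures `μa` (right-invariant by ★ `isMulRightInvariant_of_modularCharacterFun_eq_one` ∘ ★ `modularCharacterFun_arch_eq_one`)
and `μf` (★ `locallyCompactSpace_finAdelic`, Mathlib `Measure.haar`).  None of the (V-τ) letters `hPL hCT hMS` mentions that frame, so nothing else changes.
-/
import Summits.HodgeConjecture.HodgeConjecture.Theorems.R90S8ResGMidBlockNeBotOfTauGeneratorLettersU3   -- ★ p865372 (K2E1-p14 (g5)): (V-τ) ED. 1 `resGMidBlock_ne_bot_of_tauGenerator_letters`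
import Summits.HodgeConjecture.HodgeConjecture.Theorems.R90S8ResGMidBlockNeBotOfRecordFramedU3         -- ★ p865286 (R90-CS-p03 (g4)): the (V) frame pack — imported for its dischargers' closure (★ `exists_haar_coveringWeight_unfoldedMeasure_cm_three`, modular-character road, compactness lemmas)
import HarnessLib

/-!
# S8 socket (V) :358, general sub-row — `R90S8ResGMidBlockNeBotOfTauGeneratorLettersFramedU3`: K2E1-p14's (V-τ) letter head ★ p865372, FRAMED (exports' frame (F)(F′) discharged)

Track B ∕ K2-LIT, crux h413 = `stmt-HodgeConjecture-24833`, route of record `HCCMUnconditional`; cell `hodgecm-mathlib`, R90-TF section S8 «ContSpec-n½», socket (V)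
`sock_S8_res_midBlock_ne_bot` (B :358), GENERAL SUB-ROW (V-τ) (J-S8-M3′ (c)).  THEOREMS ONLY (no `def`, no `instance`, no `notation`, no named-fact hypothesis, no `sorry`; default
heartbeats); lane `--supports stmt-HodgeConjecture-24833 --as helper` (count-neutral).  CLOSES NO SOCKET and PAYS NO LETTER: it shortens (V-τ)'s binder list by the exports' frame.

WHAT RIDES (= ★ p865372's head minus the frame): B's frame `L μ μω hμu hμω ξ` + the `G(𝔸)` σ-algebra; the τ-admissible witness `U₀ hU₀ φ hφ hφc hφa`; the normalised Heisenberg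
package `ν 𝓕 h𝓕N h𝓕c h𝓕1`; the letters `hPL` (pole ledger), row (ii) `D … hCT q qc … hφtbd`, row (iii) `S T′ … A hA hsrc hA32`, `hMS`.  WHAT IS DISCHARGED: `[MeasurableSpace∕BorelSpace]`
on `G_∞`, `G_f`; `νG [IsHaarMeasure] [IsInvInvariant] [SFinite]`, `β hβ`, `μZ [SFinite] hμZ`; `μa [IsHaarMeasure] [IsMulRightInvariant]`; `μf [IsHaarMeasure]`.
* **`resGMidBlock_ne_bot_of_tauGenerator_letters_framed`** — ★ p865372's conclusion from the riding binders only.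
HONEST LABEL: HC_CM is proved only modulo the 7 printed citations (2 remaining named inputs: hLiu418 = `stmt-HodgeConjecture-24832`, h413 = `stmt-HodgeConjecture-24833`) until
rung 0 closes; REL ≠ ★ ≠ BUILT; frame plumbing, no letter paid, no socket closed (:358 stays `sorry` in B); count-neutral.

## References
* [Rogawski1990] J. D. Rogawski, *Automorphic Representations of Unitary Groups in Three Variables* (1990), §13.9 (ii) p. 229, §14.2 p. 232.
* [MoeglinWaldspurger1995] C. Mœglin, J.-L. Waldspurger, *Spectral Decomposition and Eisenstein Series* (1995), IV.1.11, V.3.13.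
* [WeilIntegration1965] A. Weil, *L'intégration dans les groupes topologiques et ses applications* (2ᵉ éd., 1965), §9.
-/

set_option autoImplicit false
set_option linter.dupNamespace false  -- the mandated namespace `…HodgeConjecture.HodgeConjecture.R90.S8` (LEAD #1 L1) repeats the summit's segment

noncomputable section

open MeasureTheory Measure NumberField IsDedekindDomain Set Filter Topology Metric Function
open scoped ENNReal NNReal MatrixGroups
open Literature.MeasureTheory.Group Literature.NumberTheory
open Literature.NumberTheory.Automorphic Literature.NumberTheory.Automorphic.UnitaryGroup Literature.NumberTheory.LFunctions Literature.NumberTheory.GaloisRepresentations AdelicGroupData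
open Literature.NumberTheory.Automorphic.Arthur2013.Leaves.TECR Literature.NumberTheory.Rogawski1990 ContRepresentation
open Summit.HodgeConjecture.HodgeConjecture.Cruxes.H413.K2E1BorelEisensteinU
open Summit.HodgeConjecture.HodgeConjecture.Cruxes.H413.K2E1BLBorelSpacesU2Defs
open Summit.HodgeConjecture.HodgeConjecture.Cruxes.H413.K2E1BLBorelOperatorsU2Defs
open Summit.HodgeConjecture.HodgeConjecture.Cruxes.H413.K2E1CharacterEisensteinU2Defs
open Summit.HodgeConjecture.HodgeConjecture.Cruxes.H413.K2E1ChiSectionSpaceU2Defs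
open Summit.HodgeConjecture.HodgeConjecture.Cruxes.H413.K2E1CharacterEisensteinU3PairDefs
open Summit.HodgeConjecture.HodgeConjecture.Cruxes.H413.K2E1ChiSectionSpaceU3PairDefs
open Summit.HodgeConjecture.HodgeConjecture.Cruxes.H413.K2E1HeckeLHalfNeZeroDefs (LHalfNeZero)
open Summit.HodgeConjecture.HodgeConjecture.Cruxes.H413.K2E1ChiEisensteinPoleLedgerCMThree (continuous_at_removable_of_joint_bound locally_bounded_at_removable_of_joint_bound)

open Summit.HodgeConjecture.HodgeConjecture.Cruxes.H413.K2E1SphericalEisensteinStructuralDataCMThree (exists_haar_coveringWeight_unfoldedMeasure_cm_three)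

namespace Summit.HodgeConjecture.HodgeConjecture.R90.S8

variable (L : Type) [Field L] [NumberField L] [IsCMField L]
  [MeasurableSpace (quasiSplit (↥(maximalRealSubfield L)) L (IsCMField.complexConj L) 3).Adelic] [BorelSpace (quasiSplit (↥(maximalRealSubfield L)) L (IsCMField.complexConj L) 3).Adelic]

/-- **(V-τ) LETTER HEAD, FRAMED — `LHalfNeZero (ξ.bcη⁻¹·μω) → resGMidBlock L μ ξ μω ≠ ⊥` from a τ-admissible witness `(U₀, φ)`, the normalised Heisenberg package and the
(V-τ) letters `hPL hCT hMS` + rows (ii)(iii)**, WITHOUT the exports' frame: the σ-algebras of `G_∞`∕`G_f`, the cluster `νG β μZ hβ hμZ` (★ `exists_haar_coveringWeight_unfoldedMeasure_cm_three`)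
and the port Haar measures `μa μf` are chosen inside (★ p865286's roads), then `exact resGMidBlock_ne_bot_of_tauGenerator_letters …` (★ p865372). [cite: Rogawski1990, §13.9 (ii) p. 229, §14.2 p. 232]
[cite: MoeglinWaldspurger1995, IV.1.11] [cite: WeilIntegration1965, §9] -/
theorem resGMidBlock_ne_bot_of_tauGenerator_letters_framed
    (μ : Measure (quasiSplit (↥(maximalRealSubfield L)) L (IsCMField.complexConj L) 3).automorphicQuotient) [(quasiSplit (↥(maximalRealSubfield L)) L (IsCMField.complexConj L) 3).IsAutomorphicMeasure μ]
    (μω : HeckeCharacter L) (hμu : μω.IsUnitary)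
    (hμω : ∀ x : ideleGroup ↥(maximalRealSubfield L), μω (AdeleRing.ideleBaseChange (↥(maximalRealSubfield L)) L x) = quadraticHeckeCharCM L x)
    (ξ : OneDimAutRepH L)
    -- (i) THE τ-ADMISSIBLE WITNESS AS DATA: a τ-level `U₀`, a continuous `K_∞`-finite pair-section of level `(ι_f U₀, 1)` (e.g. the shifted pure tensor `Φ^{p,q}_∞ ⊗ Φ_f`)
    (U₀ : Subgroup ↥(finAdelic (↥(maximalRealSubfield L)) L (IsCMField.complexConj L) 3 ((StdForm.antidiagonal 3).over L))) (hU₀ : IsTauLevel L U₀)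
    (φ : (quasiSplit (↥(maximalRealSubfield L)) L (IsCMField.complexConj L) 3).Adelic → ℂ) (hφ : φ ∈ chiSectionSpacePair (ξ.bcη⁻¹ * ξ.bcψ⁻¹ * μω) ξ.ψ (tauLevel L U₀) ((1 : ↥(tauLevel L U₀) →* ℂ) : ↥(tauLevel L U₀) → ℂ)) (hφc : Continuous φ) (hφa : IsArchFinite L φ)
    -- the NORMALISED Heisenberg package of ★ p865131's row (Haar, inversion-invariant, `ν 𝓕 = 1`)
    (ν : Measure ↥(adelicUnipotent (↥(maximalRealSubfield L)) L (IsCMField.complexConj L) 3)) [ν.IsHaarMeasure] [ν.IsInvInvariant]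
    {𝓕 : Set ↥(adelicUnipotent (↥(maximalRealSubfield L)) L (IsCMField.complexConj L) 3)}
    (h𝓕N : IsFundamentalDomain ↥(rationalUnipotent (↥(maximalRealSubfield L)) L (IsCMField.complexConj L) 3) 𝓕 ν) (h𝓕c : IsCompact (closure 𝓕)) (h𝓕1 : ν 𝓕 = 1)
    -- (i) LETTER — THE POLE LEDGER over the exported continuation (estate T's `hPL` clause shape; payers: τ-MS32 ★ p865152, the off-axis machinery of (R)′τ V3)
    (hPL : ∀ (Ec : ℂ → (quasiSplit (↥(maximalRealSubfield L)) L (IsCMField.complexConj L) 3).Adelic → ℂ) (P : Set ℂ), (∀ z : ℂ, 2 < z.re → Ec z = eisensteinSeriesU (flatSectionU φ z)) →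
      (∀ z₀ : ℂ, ∀ᶠ s in 𝓝[≠] z₀, s ∉ P) → (∀ g (z : ℂ), z ∉ P → AnalyticAt ℂ (fun z => Ec z g) z) →
      (∀ z₀ ∈ P, 1 < z₀.re → z₀ ≠ ((3 : ℂ) / 2) → ∀ K : Set (quasiSplit (↥(maximalRealSubfield L)) L (IsCMField.complexConj L) 3).Adelic, IsCompact K → ∃ C : ℝ, ∀ᶠ z in 𝓝[≠] z₀, ∀ g ∈ K, ‖Ec z g‖ ≤ C) ∧
      (∀ g, ∃ C : ℝ, ∀ᶠ z in 𝓝[≠] ((3 : ℂ) / 2), ‖(z - ((3 : ℂ) / 2)) * Ec z g‖ ≤ C))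
    -- (ii) ★ p863385's row (ii): the domain `D` and the scalar road's letters; the constant-term identity as a LETTER over the exported continuation OFF its candidate set (payers as in the rows head)
    {D : Set ℂ} (hDo : IsOpen D) (hD : ∀ᶠ z in 𝓝[≠] ((3 : ℂ) / 2), z ∈ D) (hDsub : D ⊆ ({z : ℂ | 1 < z.re} \ (↑({(3 : ℂ) / 2} : Finset ℂ) : Set ℂ)))
    (ψ φt : ℂ → (quasiSplit (↥(maximalRealSubfield L)) L (IsCMField.complexConj L) 3).Adelic → ℂ)
    (hCT : ∀ (Ec : ℂ → (quasiSplit (↥(maximalRealSubfield L)) L (IsCMField.complexConj L) 3).Adelic → ℂ) (P : Set ℂ), (∀ z : ℂ, 2 < z.re → Ec z = eisensteinSeriesU (flatSectionU φ z)) →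
      (∀ z₀ : ℂ, ∀ᶠ s in 𝓝[≠] z₀, s ∉ P) → (∀ g (z : ℂ), z ∉ P → AnalyticAt ℂ (fun z => Ec z g) z) →
      ∀ z ∈ D, z ∉ P → ∀ g : (quasiSplit (↥(maximalRealSubfield L)) L (IsCMField.complexConj L) 3).Adelic, borelConstantTerm ν 𝓕 (Ec z) g = φ g * (((borelHeight g : ℝ≥0) : ℝ) : ℂ) ^ z + ψ z g * (((borelHeight g : ℝ≥0) : ℝ) : ℂ) ^ (2 - z))
    (q qc : ℂ → ℂ) {Pq : Set ℂ} (hqcq : ∀ z : ℂ, 2 < z.re → qc z = q z) (hPqcd : ∀ z₀ : ℂ, ∀ᶠ s in 𝓝[≠] z₀, s ∉ Pq) (hqa : ∀ z : ℂ, z ∉ Pq → AnalyticAt ℂ qc z)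
    (hfac : ∀ᶠ z in 𝓝[≠] ((3 : ℂ) / 2), ∀ g, ψ z g = qc z * φt z g) (hφt : ∀ g, ContinuousAt (fun z => φt z g) ((3 : ℂ) / 2))
    {g₀ : (quasiSplit (↥(maximalRealSubfield L)) L (IsCMField.complexConj L) 3).Adelic} (hg₀ : φt ((3 : ℂ) / 2) g₀ ≠ 0) {Cφt : ℝ} (hφtbd : ∀ g, ‖φt ((3 : ℂ) / 2) g‖ ≤ Cφt)
    -- (iii) ★ p863385's row (iii) VERBATIM (payers: ★ p864821 + ★ `hA32_shifted_of_record_at_basePoint_of_modEq` for the shifted pure tensor)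
    {S : Set (HeightOneSpectrum (𝓞 L))} {T' : Set (HeightOneSpectrum (𝓞 ↥(maximalRealSubfield L)))}
    (hS : S.Finite) (hurφ : ∀ w ∉ S, (ξ.bcη⁻¹ * μω).IsUnramifiedAt w) (hT' : T'.Finite) (hurη : ∀ v ∉ T', (1 : HeckeCharacter ↥(maximalRealSubfield L)).IsUnramifiedAt v)
    (A : ℂ → ℂ) (hA : DifferentiableOn ℂ A {z : ℂ | 1 < z.re})
    (hsrc : ∀ z : ℂ, 2 < z.re → q z = A z *
          ((partialStandardL S (fun w => {(ξ.bcη⁻¹ * μω).valueAtUniformizer w}) (z - 1) * partialStandardL T' (fun v => {(1 : HeckeCharacter ↥(maximalRealSubfield L)).valueAtUniformizer v}) (2 * z - 2)) /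
            (partialStandardL S (fun w => {(ξ.bcη⁻¹ * μω).valueAtUniformizer w}) z * partialStandardL T' (fun v => {(1 : HeckeCharacter ↥(maximalRealSubfield L)).valueAtUniformizer v}) (2 * z - 1))))
    (hA32 : A (3 / 2) ≠ 0)
    -- (i′) LETTER — the Maass–Selberg bound at the middle pole for the exported truncated family (`T := 1`; payer: ★ p865152 `hMS32_midWitness_of_coordLetters (hqa32) (hreal)`)
    (hMS : ∀ (Ec : ℂ → (quasiSplit (↥(maximalRealSubfield L)) L (IsCMField.complexConj L) 3).Adelic → ℂ) (P : Set ℂ) (Fam : ℂ → (quasiSplit (↥(maximalRealSubfield L)) L (IsCMField.complexConj L) 3).L2 μ), (∀ z : ℂ, 2 < z.re → Ec z = eisensteinSeriesU (flatSectionU φ z)) →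
      (∀ z₀ : ℂ, ∀ᶠ s in 𝓝[≠] z₀, s ∉ P) → (∀ g (z : ℂ), z ∉ P → AnalyticAt ℂ (fun z => Ec z g) z) →
      DifferentiableOn ℂ Fam Pᶜ → (∀ z : ℂ, z ∉ P → ((Fam z : (quasiSplit (↥(maximalRealSubfield L)) L (IsCMField.complexConj L) 3).L2 μ) : (quasiSplit (↥(maximalRealSubfield L)) L (IsCMField.complexConj L) 3).automorphicQuotient → ℂ) =ᵐ[μ] (quasiSplit (↥(maximalRealSubfield L)) L (IsCMField.complexConj L) 3).quotFun (truncation ν 𝓕 1 (Ec z))) →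
      ∃ C : ℝ, ∀ᶠ z in 𝓝[≠] ((3 : ℂ) / 2), ‖(z - ((3 : ℂ) / 2)) • Fam z‖ ≤ C) :
    LHalfNeZero (ξ.bcη⁻¹ * μω) → resGMidBlock L μ ξ μω ≠ ⊥ := by
  -- F1′: Borel σ-algebras on `G_∞` and `G_f`
  letI : MeasurableSpace ↥(arch (↥(maximalRealSubfield L)) L (IsCMField.complexConj L) 3 ((StdForm.antidiagonal 3).over L)) := borel _
  haveI : BorelSpace ↥(arch (↥(maximalRealSubfield L)) L (IsCMField.complexConj L) 3 ((StdForm.antidiagonal 3).over L)) := ⟨rfl⟩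
  letI : MeasurableSpace ↥(finAdelic (↥(maximalRealSubfield L)) L (IsCMField.complexConj L) 3 ((StdForm.antidiagonal 3).over L)) := borel _
  haveI : BorelSpace ↥(finAdelic (↥(maximalRealSubfield L)) L (IsCMField.complexConj L) 3 ((StdForm.antidiagonal 3).over L)) := ⟨rfl⟩
  -- F3: the `G`-side structural cluster `νG β μZ` (★ one-shot package)
  obtain ⟨νG, β, μZ, hH, -, hI, hSF, hβ, hSZ, hμZ⟩ := exists_haar_coveringWeight_unfoldedMeasure_cm_three L
  haveI := hH
  haveI := hI
  haveI := hSF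
  haveI := hSZ
  -- instance preamble for the Haar choices (as in ★ p865286)
  haveI := t2Space_adeleRing_of_numberField L
  haveI := locallyCompactSpace_adeleRing' L
  haveI : T2Space (quasiSplit (↥(maximalRealSubfield L)) L (IsCMField.complexConj L) 3).Adelic :=
    inferInstanceAs (T2Space (adelic (↥(maximalRealSubfield L)) L (IsCMField.complexConj L) 3 ((StdForm.antidiagonal 3).over L)))
  haveI : LocallyCompactSpace ↥(finAdelic (↥(maximalRealSubfield L)) L (IsCMField.complexConj L) 3 ((StdForm.antidiagonal 3).over L)) :=
    locallyCompactSpace_finAdelic (↥(maximalRealSubfield L)) L (IsCMField.complexConj L) 3 ((StdForm.antidiagonal 3).over L)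
  -- F5 F6: the port Haar measures on `G_∞` (right-invariant by the modular-character road) and `G(𝔸_f)`
  set μa : Measure ↥(arch (↥(maximalRealSubfield L)) L (IsCMField.complexConj L) 3 ((StdForm.antidiagonal 3).over L)) := Measure.haar with hμa
  haveI : μa.IsMulRightInvariant :=
    isMulRightInvariant_of_modularCharacterFun_eq_one (modularCharacterFun_arch_eq_one L ((StdForm.antidiagonal 3).over L) (cmConj_antidiagonal_transpose L (N := 3)) (isUnit_det_antidiagonal_over L (N := 3)).ne_zero) μa
  set μf : Measure ↥(finAdelic (↥(maximalRealSubfield L)) L (IsCMField.complexConj L) 3 ((StdForm.antidiagonal 3).over L)) := Measure.haar with hμf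
  exact resGMidBlock_ne_bot_of_tauGenerator_letters L μ μω hμu hμω ξ νG hβ hμZ μa μf U₀ hU₀ φ hφ hφc hφa ν h𝓕N h𝓕c h𝓕1 hPL hDo hD hDsub ψ φt hCT q qc hqcq hPqcd hqa hfac hφt hg₀ hφtbd
    hS hurφ hT' hurη A hA hsrc hA32 hMS

end Summit.HodgeConjecture.HodgeConjecture.R90.S8

end
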